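import Summits.QuantumFields.YangMills.Theorems.FlatTubeReductionGaugeDevLevelWeight
import Summits.QuantumFields.YangMills.Theorems.LuscherReductionTwistedTraceScalingBTProductForm
import Summits.QuantumFields.YangMills.Theorems.LuscherReductionTwistedTraceScalingBTCoreWeight
import Summits.QuantumFields.YangMills.Theorems.LuscherReductionTwistedTraceScalingBTFibreProfile
import HarnessLib

/-!
# The colour-localised BO kernel with the gauge-deviation moment weight is dominated by the kinetic level weight

Support file for the crux `NearFlatRatioLaw` (line `ratepack_v2`, stub `stub_hODpot_A`, step (R3b-ii) of
`Cruxes/NearFlatRatioLaw/Lines/ratepack-v7-moments-g18.md` §10).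

`…FibreFactorReweighted.fibre_factor_moment_le_reweighted` leaves `fpBOKernel β Ω' (coreWeight·(1+βG)^j) 1 1` with a reweighted
profile `Ω'`; by `…GaugeDevLevelWeight` the weight `(1 + βG)^j` is at most `C_L^j (1 + β·kin + β‖x‖² + β‖x'‖²)^j` on the Faddeev–Popov
slice, and `coreWeight ≤ fpWeight`; writing the kernel as one integral of `fpTriple` (`…BTProductForm.fpBOKernel_eq_integral_prod`):
`fpBOKernel β Ω' (coreWeight·(1+βG)^j) 1 1 ≤ C_L^j ∫ fpTriple β Ω' (fpWeight ε) 1 1 · (1 + β·kin + β‖x‖² + β‖x'‖²)^j`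
(`fpBOKernel_gaugeDev_le_levelWeight`) — the left side of `…ReweightedProfile.integral_levelWeight_le_reweighted`, i.e. the entrance of the
reference-moment machine (`…ReferenceMoments.reference_moment_le`, `…ReferenceMassBounds`).
-/

noncomputable section

open MeasureTheory Filter Topology Real
open scoped BigOperators
open Literature.MathematicalPhysics.QuantumFieldTheory
open Literature.MathematicalPhysics.QuantumLattice

namespace Summit.QuantumFields.YangMills.Theorems.FemtoTransferGap.TwoLattice.ConstTube

open Summit.QuantumFields.YangMills.Theorems.FemtoTransferGap
open Summit.QuantumFields.YangMills.Theorems.FemtoTransferGap.TwoLattice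
open Summit.QuantumFields.YangMills.Theorems.FemtoTransferGap.TwoLattice.Avg
open Summit.QuantumFields.YangMills.Theorems.FemtoTransferGap.TwoLattice.Stiff (LinkSpace)

variable {L : ℕ} [NeZero L]

/-- A fibre point of Euclidean norm `≤ 1` has every link component of square-norm `≤ 1`. [folklore] -/
theorem linkComp_sq_sum_le_one_of_norm_le {v : Edge 3 L → Fin 3 → ℝ} (hv : ‖linkEmbed L v‖ ≤ 1) (e : Edge 3 L) : ∑ a, v e a ^ 2 ≤ 1 := by
  have h1 : ∑ a, v e a ^ 2 ≤ ‖linkEmbed L v‖ ^ 2 := by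
    rw [norm_linkEmbed_sq]
    exact Finset.single_le_sum (f := fun e' => ∑ a, v e' a ^ 2) (fun e' _ => Finset.sum_nonneg fun a _ => sq_nonneg _) (Finset.mem_univ e)
  have h2 : ‖linkEmbed L v‖ ^ 2 ≤ 1 := by nlinarith [norm_nonneg (linkEmbed L v)]
  exact h1.trans h2

/-- ★★ **THE FIBRE KERNEL WITH THE GAUGE-DEVIATION WEIGHT ≤ THE LEVEL-WEIGHTED REFERENCE MASS** (see the module docstring):
`β ≥ 0`, `βε² ≤ 1`; a profile `Ω'` (bounded measurable, `≥ 0`, supported in the capped balanced set with `‖x̂‖ ≤ R ≤ 1`); the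
level-weighted reference integrand integrable. [cite: Luscher1983, §3] -/
theorem fpBOKernel_gaugeDev_le_levelWeight {β ε R₁ : ℝ} (hβ : 0 ≤ β) (hε : β * ε ^ 2 ≤ 1) {Ω' : LinkSpace L → ℝ} (hΩm : Measurable Ω') {CΩ : ℝ}
    (hCΩ : ∀ x, |Ω' x| ≤ CΩ) (hΩ0 : ∀ x, 0 ≤ Ω' x) {R : ℝ} (hR1 : R ≤ 1)
    (hΩt : ∀ v : Edge 3 L → Fin 3 → ℝ, Ω' (linkEmbed L v) ≠ 0 → v ∈ capBalancedSet L ∧ ‖linkEmbed L v‖ ≤ R) (j : ℕ)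
    (hint : Integrable (fun p : (Edge 3 L → Fin 3 → ℝ) × ((Edge 3 L → Fin 3 → ℝ) × (Site 3 L → SU2)) =>
      fpTriple L β Ω' (fpWeight L ε) 1 1 p * (1 + β * kinDefect L (orthoTube L 1 p.1) (orthoTube L 1 p.2.1) p.2.2 + β * ‖linkEmbed L p.1‖ ^ 2 + β * ‖linkEmbed L p.2.1‖ ^ 2) ^ j)
      ((orthoTransverse L).prod ((orthoTransverse L).prod (gaugeMeasure L)))) :
    fpBOKernel L β Ω' (fun g => coreWeight L ε R₁ g * (1 + β * ∑ y, ‖su2Quat (g y) - 1‖ ^ 2) ^ j) 1 1 ≤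
      (1 + (Fintype.card (Site 3 L) : ℝ) * (24300 * (L : ℝ) ^ 2 + 2)) ^ j *
        ∫ p, fpTriple L β Ω' (fpWeight L ε) 1 1 p *
          (1 + β * kinDefect L (orthoTube L 1 p.1) (orthoTube L 1 p.2.1) p.2.2 + β * ‖linkEmbed L p.1‖ ^ 2 + β * ‖linkEmbed L p.2.1‖ ^ 2) ^ j
          ∂((orthoTransverse L).prod ((orthoTransverse L).prod (gaugeMeasure L))) := by
  haveI : SecondCountableTopology SU2 := secondCountableTopology_su2
  haveI := isFiniteMeasure_orthoTransverse L
  set C : ℝ := 1 + (Fintype.card (Site 3 L) : ℝ) * (24300 * (L : ℝ) ^ 2 + 2) with hC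
  have hC0 : 0 ≤ C := by rw [hC]; positivity
  have hG := fun g : Site 3 L → SU2 => gaugeDevSq_mem g
  -- the reweighted core weight: bounded measurable
  have hWjm : Measurable fun g : Site 3 L → SU2 => coreWeight L ε R₁ g * (1 + β * ∑ y, ‖su2Quat (g y) - 1‖ ^ 2) ^ j :=
    (measurable_coreWeight (L := L) ε R₁).mul ((measurable_const.add (measurable_gaugeDevSq.const_mul β)).pow_const j)
  have hlev0 : ∀ g : Site 3 L → SU2, 0 ≤ 1 + β * ∑ y, ‖su2Quat (g y) - 1‖ ^ 2 := fun g => by nlinarith [(hG g).1]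
  have hWjb : ∀ g : Site 3 L → SU2, |coreWeight L ε R₁ g * (1 + β * ∑ y, ‖su2Quat (g y) - 1‖ ^ 2) ^ j| ≤ 1 * (1 + β * (4 * Fintype.card (Site 3 L))) ^ j := fun g => by
    rw [abs_mul, abs_of_nonneg (coreWeight_mem_Icc (L := L) ε R₁ g).1, abs_of_nonneg (pow_nonneg (hlev0 g) j)]
    exact mul_le_mul (coreWeight_mem_Icc (L := L) ε R₁ g).2 (pow_le_pow_left₀ (hlev0 g) (by nlinarith [(hG g).2]) j) (pow_nonneg (hlev0 g) j) zero_le_one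
  rw [fpBOKernel_eq_integral_prod β hΩm hCΩ hWjm hWjb 1 1, ← integral_const_mul]
  obtain ⟨B, hB⟩ := abs_fpTriple_le (L := L) β hCΩ hWjb 1 1
  have hLint : Integrable (fpTriple L β Ω' (fun g => coreWeight L ε R₁ g * (1 + β * ∑ y, ‖su2Quat (g y) - 1‖ ^ 2) ^ j) 1 1)
      ((orthoTransverse L).prod ((orthoTransverse L).prod (gaugeMeasure L))) :=
    integrable_of_measurable_abs_le _ (measurable_fpTriple β hΩm hWjm 1 1) hB
  refine integral_mono hLint (hint.const_mul _) fun p => ?_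
  -- pointwise
  show fpTriple L β Ω' (fun g => coreWeight L ε R₁ g * (1 + β * ∑ y, ‖su2Quat (g y) - 1‖ ^ 2) ^ j) 1 1 p ≤
    C ^ j * (fpTriple L β Ω' (fpWeight L ε) 1 1 p *
      (1 + β * kinDefect L (orthoTube L 1 p.1) (orthoTube L 1 p.2.1) p.2.2 + β * ‖linkEmbed L p.1‖ ^ 2 + β * ‖linkEmbed L p.2.1‖ ^ 2) ^ j)
  unfold fpTriple
  have hK := (transferKernel_pos su2Rep β (orthoTube L 1 p.1) (gaugeTransform p.2.2 (orthoTube L 1 p.2.1))).le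
  have hfp0 := (fpWeight_mem_Icc L ε p.2.2).1
  have hcw0 := (coreWeight_mem_Icc (L := L) ε R₁ p.2.2).1
  have hcwle : coreWeight L ε R₁ p.2.2 ≤ fpWeight L ε p.2.2 := by
    unfold coreWeight; exact Set.indicator_le_self' (fun _ _ => (fpWeight_mem_Icc L ε p.2.2).1) _
  have hlev : 0 ≤ 1 + β * kinDefect L (orthoTube L 1 p.1) (orthoTube L 1 p.2.1) p.2.2 + β * ‖linkEmbed L p.1‖ ^ 2 + β * ‖linkEmbed L p.2.1‖ ^ 2 := by
    have := kinDefect_nonneg (L := L) (orthoTube L 1 p.1) (orthoTube L 1 p.2.1) p.2.2; positivity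
  -- reduce to the weight comparison `cw·(1+βG)^j ≤ C^j · fpW · level^j` whenever both profiles are alive
  by_cases hx : Ω' (linkEmbed L p.1) = 0
  · simp only [hx, zero_mul, mul_zero, le_refl]
  by_cases hx' : Ω' (linkEmbed L p.2.1) = 0
  · simp only [hx', zero_mul, mul_zero, le_refl]
  have hv1 := fun e => linkComp_sq_sum_le_one_of_norm_le ((hΩt p.1 hx).2.trans hR1) e
  have hv'1 := fun e => linkComp_sq_sum_le_one_of_norm_le ((hΩt p.2.1 hx').2.trans hR1) e
  have hw : coreWeight L ε R₁ p.2.2 * (1 + β * ∑ y, ‖su2Quat (p.2.2 y) - 1‖ ^ 2) ^ j ≤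
      C ^ j * (fpWeight L ε p.2.2 * (1 + β * kinDefect L (orthoTube L 1 p.1) (orthoTube L 1 p.2.1) p.2.2 + β * ‖linkEmbed L p.1‖ ^ 2 + β * ‖linkEmbed L p.2.1‖ ^ 2) ^ j) := by
    by_cases hg : coreWeight L ε R₁ p.2.2 = 0
    · rw [hg, zero_mul]; exact mul_nonneg (pow_nonneg hC0 j) (mul_nonneg hfp0 (pow_nonneg hlev j))
    · have hfp : fpWeight L ε p.2.2 ≠ 0 := fun h => hg (le_antisymm (h ▸ hcwle) hcw0)
      have hball := mem_fpBall_of_fpWeight_ne_zero (L := L) hfp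
      have hdom := one_add_beta_gaugeDev_pow_le_levelWeight (L := L) hβ hε hv1 hv'1 hball j
      rw [← hC] at hdom
      calc coreWeight L ε R₁ p.2.2 * (1 + β * ∑ y, ‖su2Quat (p.2.2 y) - 1‖ ^ 2) ^ j
          ≤ fpWeight L ε p.2.2 * (C ^ j * (1 + β * kinDefect L (orthoTube L 1 p.1) (orthoTube L 1 p.2.1) p.2.2 + β * ‖linkEmbed L p.1‖ ^ 2 + β * ‖linkEmbed L p.2.1‖ ^ 2) ^ j) :=
            mul_le_mul hcwle hdom (pow_nonneg (hlev0 _) j) hfp0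
        _ = C ^ j * (fpWeight L ε p.2.2 * (1 + β * kinDefect L (orthoTube L 1 p.1) (orthoTube L 1 p.2.1) p.2.2 + β * ‖linkEmbed L p.1‖ ^ 2 + β * ‖linkEmbed L p.2.1‖ ^ 2) ^ j) := by ring
  have h2 := mul_le_mul_of_nonneg_left (mul_le_mul_of_nonneg_right (mul_le_mul_of_nonneg_right hw hK) (hΩ0 (linkEmbed L p.2.1))) (hΩ0 (linkEmbed L p.1))
  calc Ω' (linkEmbed L p.1) * (coreWeight L ε R₁ p.2.2 * (1 + β * ∑ y, ‖su2Quat (p.2.2 y) - 1‖ ^ 2) ^ j *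
        transferKernel su2Rep β (orthoTube L 1 p.1) (gaugeTransform p.2.2 (orthoTube L 1 p.2.1)) * Ω' (linkEmbed L p.2.1))
      ≤ Ω' (linkEmbed L p.1) * (C ^ j * (fpWeight L ε p.2.2 * (1 + β * kinDefect L (orthoTube L 1 p.1) (orthoTube L 1 p.2.1) p.2.2 + β * ‖linkEmbed L p.1‖ ^ 2 +
          β * ‖linkEmbed L p.2.1‖ ^ 2) ^ j) * transferKernel su2Rep β (orthoTube L 1 p.1) (gaugeTransform p.2.2 (orthoTube L 1 p.2.1)) * Ω' (linkEmbed L p.2.1)) := h2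
    _ = C ^ j * (Ω' (linkEmbed L p.1) * (fpWeight L ε p.2.2 * transferKernel su2Rep β (orthoTube L 1 p.1) (gaugeTransform p.2.2 (orthoTube L 1 p.2.1)) * Ω' (linkEmbed L p.2.1)) *
        (1 + β * kinDefect L (orthoTube L 1 p.1) (orthoTube L 1 p.2.1) p.2.2 + β * ‖linkEmbed L p.1‖ ^ 2 + β * ‖linkEmbed L p.2.1‖ ^ 2) ^ j) := by ring

end Summit.QuantumFields.YangMills.Theorems.FemtoTransferGap.TwoLattice.ConstTube

end
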